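import Summits.BirchSwinnertonDyer.Rank1Residual.X5.TwoAdicAdditiveL2
import Summits.BirchSwinnertonDyer.BirchSwinnertonDyer.Theorems.Rank1ResidualX1Defs
import Literature.NumberTheory.EllipticCurves.PAdicLFunctionMinus
import HarnessLib

/-!
# ROUTE-L2, MEMO-2 (lens «around», ADDITIVE 2): the `K*`-road — cyclotomic Iwasawa theory of the
# SEMISTABLE twist over the quadratic subfield `K* ⊂ ℚ(ζ₈)` that semistabilises `E`, typed as a
# `Λ`-module statement; descent over `K*`; and the rank-0 2-converse over `K*` (μ-blind)

Cell `bsd-2adic` (run/shared/lean/pub/bsd-2adic/, HUMAN RULING D-0036), seat `bsd-2adic-addL2` (GEN 2),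
memo `HOME/bsd-2adic-addL2-MEMO-2.md`; sibling of `X5/TwoAdicAdditiveL2.lean` (MEMO-1, p400731).
HONEST FRAMING: this file TYPES (as `def … : Prop` predicates with parameters — NOTHING asserted) the
inputs of the planner's routing note RN-1 made INTEGRAL, DEFINES the three `Λ_{K*}`-adic analytic
generators from the tree's plus/minus Mazur–Tate–Teitelbaum measures at `p = 2`, and PROVES only
bookkeeping assemblies. No door here has a printed far side at `p = 2`.

## The `K*`-road (memo §1–§4)

For `E/ℚ` additive at `2` and quadratically semistabilisable (563 residue classes; `X5.AddTwoL2.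
QuadSemistabilisable`), the inertial twist class is `d* ∈ {−1, 2, −2}` (census, 563/563) and the
semistable twist `E' := E^{(d*)}` becomes isomorphic to `E` over `K* := ℚ(√d*)`, one of the THREE
quadratic subfields of `ℚ(ζ₈) ⊂ ℚ(μ_{2^∞})`. The cyclotomic `ℤ₂`-extension of `K*` is
`K*_∞ = ℚ(μ_{2^∞})` for `K* = ℚ(i), ℚ(√−2)` (`Γ_{K*} ≅ 1 + 4ℤ₂`, resp. `⟨−5⟩ ⊂ ℤ₂^×`, torsion-free)
and `ℚ_∞` for `K* = ℚ(√2) = ℚ₁`. Hence the ONE-variable Iwasawa module `X(E'_{K*}/K*_∞)` — a tree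
object, `SelmerDualData (W' : WeierstrassCurve K*) κ γ` with `κ.IsCyclotomic` — IS Kato's
`ℤ₂⟦Gal(ℚ(ζ_{2^∞})/ℚ)⟧`-module of the SEMISTABLE curve `E'/ℚ` restricted to the index-`2` torsion-free
subgroup `Γ_{K*}`, and its conjectural characteristic power series is the NORM
`N(L̃) = L⁺ · L^{χ}` of the two-branch MTT `2`-adic `L`-function of `E'`:
`K* = ℚ(i)`: `L⁺(T)·L⁻_{ω}(T)` (`padicLFunction f α · padicLFunctionMinusBranch f α 1`, SAME variable
`1 + T ↔ 5`); `K* = ℚ(√−2)`: `L⁺(T)·L⁻_{χ₋₈}(T)` with `L⁻_{χ₋₈} = ∫ χ₋₈(x)(1+T)^{ℓ(x)} dμ⁻` (variable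
`1 + T ↔ −5 ∈ ⟨−5⟩`); `K* = ℚ(√2)`: `A(t)² − (1+t)·B(t)²`, `A/B` the even/odd-`ℓ` halves of `μ⁺`
(variable `1 + t ↔ 25`). What then stands between `X(E'_{K*}/K*_∞)` and `BSD₂(E)` is (i) Greenberg's
Euler-characteristic theorem over `F = K*` at `p = 2` (LNM 1716 Thm. 4.1 is printed for a general
number field `F`, good ordinary at `v ∣ p`, with the multiplicative replacements
`|ker r_v|/c_v^{(p)}`, "for any prime `p`") at the ONE semistable ramified prime `𝔭`, `𝔭² = (2)`, plus
the MTT interpolation at `T = 0` on both branches (the odd one through the tree's PROVED odd Birch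
formula `ratMinusTwistedSymbolSum_mul_minusPeriod_mul_I`) and the twist-period identity — typed here
at OUTPUT level as `CycDescentOverKAtTwo`; and (ii) Milne's Weil-restriction descent from `K*` to `ℚ`
= the KERNEL door L2-Q of MEMO-1 (`AddTwoL2.bsdp_two_of_overK_of_twist`). NO additive-reduction
Iwasawa theory, NO control theorem at an additive prime and NO `Δ = {±1}`-descent is used: the
additive curve `E` never enters except through `E_{K*} ≅ E'_{K*}`.

## Contents

* §1 `InsideTwoCyclotomic K` (`d_K ∈ {−4, 8, −8}`), `CycSemistabilising W K`.
* §2 DEFINITIONS (`p = 2`): `padicLMinusChi8RiemannSum/Coeff`, `padicLFunctionMinusChi8 f α`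
  (the `χ₋₈`-twisted minus `L`-function), `padicLHalfRiemannSum/Coeff`, `padicLFunctionHalf f α ε`
  (even/odd-`ℓ` halves of `μ⁺`), and the three generators `cycGeneratorQi`, `cycGeneratorQsqrtm2`,
  `cycGeneratorQsqrt2`.
* §3 TYPED INPUTS: `IsCycVariableOver K c γ` (normalisation `χ_cyc(γ) = c`),
  `CycMainConjectureOverKAtTwo W' c L ϖ` (the `Λ_{K*}`-IMC: `X` torsion, `char X = (g)`,
  `ι g = ϖ·L`), `CycDescentOverKAtTwo` (IMC over `K*` ⟹ `MissingPPartOverAt W' 2` at analytic rank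
  `0` over `K*`), and the μ-BLIND converse inputs `CycEisensteinDivisibilityOverKAtTwoRat`,
  `CycControlOverKAtTwoRat`, `CycInterpolationNonvanishingAtTwo`.
* §4 PROVED: `bsdp_two_of_cycRoad` (IMC over `K*` + descent + `BSD(E',2)` ⟹ `BSD(E,2)`, through door
  L2-Q), `twoConverseOverAt_zero_of_cycRoadRat` (the three ⊗ℚ inputs ⟹ `TwoConverseOverAt W K* 0`).
  The converse door with a rank-ONE auxiliary twist (memo §7) is the sibling file
  `X5/TwoAdicAdditiveL2Converse.lean`.

Census of record (MEMO-2 §5; m = 1 rows of `memos/ROUTE-L2-files/partners_joined.tsv`): `r_an(E/K*) =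
r_an(E) + r_an(E') = 0` on 188 classes (147 with `K*` imaginary), `= 1` on 302 (257 imaginary: the
Heegner setting over `K*` with `2 ∣ d_K`), `≥ 2` on 73 (there the free-`m` door of MEMO-1 remains).
-/

noncomputable section

open scoped Classical MatrixGroups ModularForm

open Filter Topology CongruenceSubgroup WeierstrassCurve Literature.NumberTheory.EllipticCurves
  Literature.NumberTheory.EllipticCurves.ModularForms
  Literature.NumberTheory.EllipticCurves.Rank1Residual
  Literature.NumberTheory.EllipticCurves.Rank1Residual.Typed
  Summit.BirchSwinnertonDyer.Rank1Residual.AdditivePotMult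
  Summit.BirchSwinnertonDyer.Rank1Residual.X5.AddTwoL2

namespace Summit.BirchSwinnertonDyer.Rank1Residual.X5.AddTwoL2Cyc

/-! ## §1 The three quadratic subfields of `ℚ(ζ₈)` -/

section Fields

variable (W : WeierstrassCurve ℚ) [W.IsElliptic]

/-- `K` is one of the three quadratic subfields of `ℚ(ζ₈) = ℚ(μ_{2^∞}) ∩ {quadratic fields}`:
`d_K ∈ {−4, 8, −8}`, i.e. `K ∈ {ℚ(i), ℚ(√2), ℚ(√−2)}`. Then the cyclotomic `ℤ₂`-extension of `K` is
`ℚ(μ_{2^∞})` (`d_K = −4, −8`; `Gal ≅ 1 + 4ℤ₂`, resp. `⟨−5⟩`, torsion-free of index `2` in `ℤ₂^×`)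
or `ℚ_∞ = ℚ(μ_{2^∞})⁺` (`d_K = 8`; `K = ℚ₁` its first layer). A predicate; nothing asserted.
[folklore] -/
def InsideTwoCyclotomic (K : Type) [Field K] [NumberField K] : Prop :=
  NumberField.discr K = -4 ∨ NumberField.discr K = 8 ∨ NumberField.discr K = -8

/-- Admissibility predicate of the `K*`-road: `K ⊂ ℚ(ζ₈)` AND the twist `E^{(d_K)}` is semistable at
`2` (`AddTwoL2.SemistableTwistAtTwo`). For `E` additive at `2` in the quadratic sub-class exactly ONE
of the three fields qualifies (`K* = ℚ(√d*)`, `d*` the inertial class; census 563/563: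
`d* = −1`: 388, `2`: 87, `−2`: 88). A predicate; nothing asserted. [folklore] -/
def CycSemistabilising (K : Type) [Field K] [NumberField K] : Prop :=
  InsideTwoCyclotomic K ∧ SemistableTwistAtTwo W K

omit [W.IsElliptic] in
/-- A `CycSemistabilising` field is admissible for MEMO-1's converse door L2-Q′. [folklore] -/
theorem semistableTwistAtTwo_of_cycSemistabilising {K : Type} [Field K] [NumberField K]
    (h : CycSemistabilising W K) : SemistableTwistAtTwo W K := h.2

omit [W.IsElliptic] in
/-- **The Friedberg–Hoffstein binder of door L2-Q′ DEGENERATES on the `K*`-road**: since `K*` is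
forced, MEMO-1's typed input (b₂) `ExistsSemistabilisingNonvanishingTwist W` is discharged by the
single decidable fact `L(E^{(d_{K*})}, 1) ≠ 0` for that one field (true on the 188 classes with
`r_an(E') = 0` of the census, false on the other 375). [folklore] -/
theorem existsSemistabilisingNonvanishingTwist_of_cycSemistabilising {K : Type} [Field K]
    [NumberField K] (h2 : Module.finrank ℚ K = 2) (hK : CycSemistabilising W K)
    (hL : (W.quadraticTwist (NumberField.discr K : ℚ)).entireLFunction 1 ≠ 0) :
    ExistsSemistabilisingNonvanishingTwist W :=
  ⟨K, inferInstance, inferInstance, h2, hK.2, hL⟩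

end Fields

/-! ## §2 The three `Λ_{K*}`-adic analytic generators at `p = 2` (definitions on the tree's measures) -/

section Generators

variable {N : ℕ} (f : CuspForm (Gamma0 N) 2)

/-- The `n`-th Riemann sum for the `k`-th coefficient of the **`χ₋₈`-twisted minus `2`-adic
`L`-function** `∫_{ℤ₂^×} χ₋₈(x) (1+T)^{ℓ(x)} dμ⁻_{f,α}(x)`: with `x = ζ·5^{ℓ(x)}`, `ζ ∈ {±1}`,
`χ₋₈(ζ 5^s) = χ₋₄(ζ)·χ₈(5)^s = ζ·(−1)^s`; literally `padicLMinusBranchRiemannSum f α 1 k n` at `p = 2`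
with the extra sign `(−1)^s` (Mazur–Tate–Teitelbaum 1986 §I.13, tame character `χ₋₈ = ω·χ₈`).
[cite: MazurTateTeitelbaum1986Invent, §I.13] -/
def padicLMinusChi8RiemannSum (α : ℚ_[2]) (k n : ℕ) : ℚ_[2] :=
  ∑ᶠ ζ : rootsOfUnity (torsionOrder 2) ℤ_[2], ∑ s : ZMod (2 ^ n),
    ((((ζ : ℤ_[2]ˣ) : ℤ_[2]) : ℚ_[2]) * (-1 : ℚ_[2]) ^ s.val *
      msdMinusMeasure f α (n + cyclotomicExponent 2)
          (PadicInt.toZModPow (n + cyclotomicExponent 2) ((ζ : ℤ_[2]ˣ) : ℤ_[2]) *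
            (cyclotomicGenerator 2 : ZMod (2 ^ (n + cyclotomicExponent 2))) ^ s.val) *
        (s.val.choose k : ℚ_[2]))

/-- The `k`-th coefficient of the `χ₋₈`-twisted minus `2`-adic `L`-function (limit of the Riemann sums;
junk value of `limUnder` if divergent, as for `padicLMinusBranchCoeff`).
[cite: MazurTateTeitelbaum1986Invent, §I.11–I.13] -/
def padicLMinusChi8Coeff (α : ℚ_[2]) (k : ℕ) : ℚ_[2] :=
  limUnder atTop (padicLMinusChi8RiemannSum f α k)

/-- **The `χ₋₈`-twisted minus `2`-adic `L`-function** `L⁻_{χ₋₈}(f, α, T) = ∫_{ℤ₂^×} χ₋₈(x)(1+T)^{ℓ(x)}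
dμ⁻_{f,α}(x) ∈ ℚ₂⟦T⟧` — the `κ`-twist (`1 + T ↦ −(1+T)`) of the odd branch
`padicLFunctionMinusBranch f α 1`; its values at characters `ψ` of `Γ` are
`α^{-m} τ(ψχ₋₈) L(f, (ψχ₋₈)⁻¹, 1)/(Ω⁻_f i)` (odd Birch formula). It is the second factor of the
`Λ_{ℚ(√−2)}`-generator (§2 `cycGeneratorQsqrtm2`). [cite: MazurTateTeitelbaum1986Invent, §I.13] -/
def padicLFunctionMinusChi8 (α : ℚ_[2]) : PowerSeries ℚ_[2] :=
  PowerSeries.mk (padicLMinusChi8Coeff f α)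

/-- The `n`-th Riemann sum for the `k`-th coefficient of the **parity-`ε` half of the plus measure in
the variable of `U² = 1 + 8ℤ₂`**: `∑_ζ ∑_{s ≡ ε (2)} μ⁺_{f,α}(ζ 5^s + 2^{n+2}ℤ₂)·((s − ε)/2 choose k)`,
a Riemann sum for `∫_{ℓ(x) ≡ ε} (1+t)^{(ℓ(x)−ε)/2} dμ⁺`, `1 + t ↔ 25 = 5²`. With `A = half 0`,
`B = half 1` one has `L⁺(f,α,T) = A(t) + (1+T)·B(t)`, `(1+T)² = 1 + t`, and the NORM of `L⁺` from
`Λ = ℤ₂⟦Gal(ℚ_∞/ℚ)⟧` to `Λ_{ℚ(√2)} = ℤ₂⟦Gal(ℚ_∞/ℚ(√2))⟧` is `A² − (1+t)B²` (§2 `cycGeneratorQsqrt2`).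
[cite: MazurTateTeitelbaum1986Invent, §I.13] -/
def padicLHalfRiemannSum (α : ℚ_[2]) (ε k n : ℕ) : ℚ_[2] :=
  ∑ᶠ ζ : rootsOfUnity (torsionOrder 2) ℤ_[2], ∑ s : ZMod (2 ^ n),
    (if s.val % 2 = ε % 2 then (((s.val - ε % 2) / 2).choose k : ℚ_[2]) else 0) *
      msdMeasure f α (n + cyclotomicExponent 2)
          (PadicInt.toZModPow (n + cyclotomicExponent 2) ((ζ : ℤ_[2]ˣ) : ℤ_[2]) *
            (cyclotomicGenerator 2 : ZMod (2 ^ (n + cyclotomicExponent 2))) ^ s.val)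

/-- The `k`-th coefficient of the parity-`ε` half of `μ⁺` in the `U²`-variable (limit of Riemann
sums; junk if divergent). [cite: MazurTateTeitelbaum1986Invent, §I.11–I.13] -/
def padicLHalfCoeff (α : ℚ_[2]) (ε k : ℕ) : ℚ_[2] :=
  limUnder atTop (padicLHalfRiemannSum f α ε k)

/-- The parity-`ε` half `∫_{ℓ(x) ≡ ε (2)} (1+t)^{(ℓ(x)−ε)/2} dμ⁺_{f,α}(x) ∈ ℚ₂⟦t⟧` of the plus
`2`-adic `L`-function in the variable `1 + t ↔ 25`. [cite: MazurTateTeitelbaum1986Invent, §I.13] -/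
def padicLFunctionHalf (α : ℚ_[2]) (ε : ℕ) : PowerSeries ℚ_[2] :=
  PowerSeries.mk (padicLHalfCoeff f α ε)

/-- **`Λ_{ℚ(i)}`-generator**: `L⁺(f,α,T) · L⁻_ω(f,α,T)` — the trivial branch times the odd (`ω = χ₋₄`)
branch of the MTT measures, in the common variable `1 + T ↔ 5 ∈ 1 + 4ℤ₂ = Gal(ℚ(μ_{2^∞})/ℚ(i))`.
It is the norm `N_{Λ̃/Λ_{ℚ(i)}}(L̃)`, `Λ̃ = ℤ₂⟦ℤ₂^×⟧ = Λ_{ℚ(i)}[±1]`, of the two-branch `2`-adic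
`L`-function `L̃ = L⁺ + [−1]·L⁻`-data of `f`: `N(a + [−1]b) = (a+b)(a−b)`; its value at a character
`ψ` of `Gal(ℚ(μ_{2^∞})/ℚ(i))` interpolates `L(f,ψ̃⁻¹,1)·L(f,(ψ̃χ₋₄)⁻¹,1) = L(f/ℚ(i), ψ⁻¹∘N, 1)`
(up to `α`-powers, Gauss sums and `Ω^±_f`). [cite: MazurTateTeitelbaum1986Invent, §I.13–I.14] -/
def cycGeneratorQi (α : ℚ_[2]) : PowerSeries ℚ_[2] :=
  padicLFunction f α * padicLFunctionMinusBranch f α 1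

/-- **`Λ_{ℚ(√−2)}`-generator**: `L⁺(f,α,T) · L⁻_{χ₋₈}(f,α,T)` in the variable
`1 + T ↔ −5 ∈ ⟨−5⟩ = Gal(ℚ(μ_{2^∞})/ℚ(√−2))` (`ℤ₂^× = ⟨−5⟩ × {±1}`, the `⟨−5⟩`-component of `x` is
`χ₋₈(x)·x`, whose `U`-projection is `⟨x⟩ = 5^{ℓ(x)}`, so the first factor is `L⁺` in the SAME
power-series variable and the second is the `χ₋₈`-twisted minus function).
[cite: MazurTateTeitelbaum1986Invent, §I.13–I.14] -/
def cycGeneratorQsqrtm2 (α : ℚ_[2]) : PowerSeries ℚ_[2] :=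
  padicLFunction f α * padicLFunctionMinusChi8 f α

/-- **`Λ_{ℚ(√2)}`-generator**: `A(t)² − (1+t)·B(t)²`, the norm from `ℤ₂⟦U⟧` to `ℤ₂⟦U²⟧` of
`L⁺ = A + [5]·B` (`[5]² = [25] = 1 + t`); its value at a character `ψ` of
`U² = Gal(ℚ_∞/ℚ(√2))` is `L⁺(ψ̃)·L⁺(ψ̃κ)` over the two extensions `ψ̃` of `ψ` to `U`, interpolating
`L(f,ψ̃⁻¹,1)·L(f,(ψ̃χ₈)⁻¹,1) = L(f/ℚ(√2), ψ⁻¹∘N, 1)`. [cite: MazurTateTeitelbaum1986Invent, §I.13–I.14] -/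
def cycGeneratorQsqrt2 (α : ℚ_[2]) : PowerSeries ℚ_[2] :=
  padicLFunctionHalf f α 0 ^ 2 - (1 + PowerSeries.X) * padicLFunctionHalf f α 1 ^ 2

end Generators

/-! ## §3 Typed inputs of the `K*`-road (predicates with parameters; NOTHING asserted) -/

section Typed

variable {K : Type} [Field K] [NumberField K]

/-- Normalisation of the topological generator over `K`: `χ_cyc(γ) = c` exactly, `χ_cyc` the `2`-adic
cyclotomic character of `Γ_K` (`Literature…GaloisRep.cyclotomicCharacter K 2`). The `K*`-road uses
`c = 5` (`K = ℚ(i)`), `c = −5` (`ℚ(√−2)`), `c = 25` (`ℚ(√2)`), matching the variables of §2. Twin of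
the tree's `IsCyclotomicVariable` (which is `ℚ`-specific and up to torsion). A predicate.
[cite: MazurTateTeitelbaum1986Invent, §I.13] -/
def IsCycVariableOver (K : Type) [Field K] [NumberField K] (c : ℤ_[2])
    (γ : Field.absoluteGaloisGroup K) : Prop :=
  ((Literature.NumberTheory.GaloisRepresentations.GaloisRep.cyclotomicCharacter K 2 γ : ℤ_[2]ˣ) :
    ℤ_[2]) = c

/-- **TYPED INPUT (I-K*) — the cyclotomic `2`-adic main conjecture for a curve over `K ⊂ ℚ(ζ₈)`,
with displayed generator.** For `W'` an elliptic curve over the number field `K`, a constant `c`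
(variable normalisation), a power series `L ∈ ℚ₂⟦T⟧` (the analytic generator) and a rational `ϖ`
(period index): for every CYCLOTOMIC `ℤ₂`-extension datum `κ` of `K`, every `γ` with `κ γ = 1` and
`χ_cyc(γ) = c`, and every Pontryagin-dual datum `D` (`X = X(W'/K_∞^{cyc})`, tree `SelmerDualData`
over `K`): `X` is `Λ`-torsion and `char_Λ X = (g)` with `ι g = ϖ · L`. USE (memo §3): `K = K*`,
`W'` a model of `E'_{K*} = E_{K*}`, `L = cycGeneratorQi / Qsqrtm2 / Qsqrt2 f α` for `f` the newform of
the SEMISTABLE twist `E'/ℚ` and `α` its unit root at `2` (good ordinary) resp. `α = a₂(E') = ±1`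
(multiplicative); `ϖ = ϖ⁺ϖ^{sgn d_K}` the Néron/modular period indices. STATUS: implied ⊗ℚ (i.e. in
`Λ[1/2]`, away from `μ`) by Kato's formulation of the IMC for `E'` over `ℚ(ζ_{2^∞})` (Conj. 12.10, both
`Δ`-branches; Kato's side 17.4 (1)(2) at `2` for good ordinary, the cell's PROOF-MULT Thm A/B for
multiplicative `2`) by restriction of scalars `Λ̃ → Λ_{K*}` (`char_{Λ_K} Res X = N(char)`); the
integral refinement is ONE `μ`-equality over `K*` (absorbing both branch `μ`'s and the gluing of the
two components of `Spec ℤ₂⟦ℤ₂^×⟧` over `2`); the Eisenstein direction is open at `2` as everywhere.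
For `K = ℚ(√2)` (`⊂ ℚ_∞`) it is implied INTEGRALLY by the tree's `MazurMainConjecture W' 2` for the
twist over `ℚ`. Nothing in print at `p = 2` over any `K ≠ ℚ`. A predicate; nothing asserted.
[cite: Kato2004Asterisque, Conj. 12.10 and Thm. 17.4 (shape; restriction to Γ_{K*} not in print)] -/
def CycMainConjectureOverKAtTwo (W' : WeierstrassCurve K) (c : ℤ_[2]) (L : PowerSeries ℚ_[2])
    (ϖ : ℚ) : Prop :=
  haveI : Fact (Nat.Prime 2) := ⟨Nat.prime_two⟩
  ∀ (κ : ZpExtension K 2) (γ : Field.absoluteGaloisGroup K),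
      κ.IsCyclotomic → κ.IsTopGenerator γ → IsCycVariableOver K c γ →
    ∀ (D : W'.SelmerDualData κ γ), D.IsTorsion ∧
      ∃ g : IwasawaAlgebra 2, D.charIdeal = Ideal.span {g} ∧
        iwasawaToPowerSeries 2 g = PowerSeries.C (ϖ : ℚ_[2]) * L

/-- **TYPED INPUT (II-K*) — descent over `K*` at analytic rank `0`, OUTPUT level.** For `W/ℚ` (the
additive curve), `K`, and `W'` a `K`-model of `W_K`: the `Λ_K`-main conjecture (I-K*) for `W'` with
generator `ϖ·L` implies, when `ord_{s=1} L(W/K,s) = 0`, the `2`-part of BSD for `W'` over `K`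
(`AdditivePotMult.MissingPPartOverAt W' 2`). CONTENT it names (memo §4): (a) Greenberg 1999 Thm. 4.1
over `F = K` at `p = 2` — printed for a general number field, good ORDINARY at `v ∣ p`, with the
multiplicative replacements `|ker r_v|/c_v^{(p)}` (`= 2` at a non-split `v`, "for any prime `p`";
split: the `ℒ`-invariant factor) — giving `ord₂ g(0) = ord₂(#Ш(E'_K)[2^∞]·Tam(E'_K)·#Ẽ'(𝔽₂)(2)²/#E'(K)(2)²)`;
(b) MTT interpolation at `T = 0` on both branches: `L⁺(0) = (1−α⁻¹)^{e}[0]⁺_f`, and the odd constant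
term `α^{-m}∑χ(a)[a/2^m]⁻_f = α^{-m}τ(χ)L(f,χ̄,1)/(Ω⁻_f i)` (tree THEOREM
`ratMinusTwistedSymbolSum_mul_minusPeriod_mul_I`); (c) `ord₂(1−α⁻¹)² = 2 ord₂ #Ẽ'(𝔽₂)` (elementary);
(d) the twist-period identity `√|d_K|·Ω_E = x·Ω^{sgn d_K}_{E'}`, `x ∈ ℚ^×` (Pal 2012) and the ratio
`u := Ω_E·Ω_{E'}·√|d_K|/Ω(E'_K)` of the product of the two `ℚ`-periods to the `K`-period: Greenberg
over `K` + Milne + BSD for `E`, `E'` FORCE `ϖ = u/x` up to a `2`-adic unit, and the seat's STEP-0 (kit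
j240383, HOME/STEP0-addL2-kstar.md, memo §5) MEASURES `u/x` on covered and residue pairs — the displayed
parameter `ϖ` of (I-K*) is that period index, never a free constant; (e) `Sel_{2^∞}(E'/K)`
finite at analytic rank `0` (Kato Cor. 14.3 for `E`, `E'` + Dokchitser² Lemma 4.14). For `E'_K` good
SUPERSINGULAR at `𝔭` (82 `C₂`-classes) (a) has no printed counterpart (signed theory over a RAMIFIED
quadratic extension of `ℚ₂`); for split multiplicative `𝔭` the exceptional-zero form of (a)–(b) is the
cell's T-mult-2-split transported to `K_𝔭`. A predicate; nothing asserted.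
[cite: GreenbergLNM1716, Thm. 4.1 (general F) and §4 multiplicative remarks (held copy chunks p0102, p0112–p0113)] -/
def CycDescentOverKAtTwo (W : WeierstrassCurve ℚ) [W.IsElliptic] (K : Type) [Field K] [NumberField K]
    (W' : WeierstrassCurve K) [W'.IsElliptic] (c : ℤ_[2]) (L : PowerSeries ℚ_[2]) (ϖ : ℚ) : Prop :=
  haveI : Fact (Nat.Prime 2) := ⟨Nat.prime_two⟩
  CycMainConjectureOverKAtTwo W' c L ϖ → analyticRankEK W K = 0 → MissingPPartOverAt W' 2

/-- **TYPED INPUT (converse, ⊗ℚ) — Eisenstein divisibility over `K*` in `ℚ₂⟦T⟧`**: for every cyclotomic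
datum and every dual datum `D`, `char X = (g)` for some `g` with `ι g ∈ L · ℚ₂⟦T⟧`. This is the LOWER
(Skinner–Urban) direction of (I-K*) up to powers of `2` and units — μ-BLIND, which is all the
2-converse needs. Open at `2` (as T-ord-3 over `ℚ`). A predicate; nothing asserted.
[cite: SkinnerUrban2014, Thm. 3.6.9 (shape only; p odd in print)] -/
def CycEisensteinDivisibilityOverKAtTwoRat (W' : WeierstrassCurve K) (c : ℤ_[2])
    (L : PowerSeries ℚ_[2]) : Prop :=
  haveI : Fact (Nat.Prime 2) := ⟨Nat.prime_two⟩
  ∀ (κ : ZpExtension K 2) (γ : Field.absoluteGaloisGroup K),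
      κ.IsCyclotomic → κ.IsTopGenerator γ → IsCycVariableOver K c γ →
    ∀ (D : W'.SelmerDualData κ γ), ∃ g : IwasawaAlgebra 2, D.charIdeal = Ideal.span {g} ∧
      ∃ h : PowerSeries ℚ_[2], iwasawaToPowerSeries 2 g = L * h

/-- **TYPED INPUT (converse, ⊗ℚ) — control over `K*` at the semistable prime, μ-blind form**: if
`corank_{ℤ₂} Sel_{2^∞}(W'/K) = 0` then for every cyclotomic datum, every dual datum and every generator
`g` of `char X`, `g(0) ≠ 0` (in `ℚ₂`). CONTENT: Mazur's control theorem at a good ordinary or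
multiplicative `𝔭 ∣ 2` of `K` (finite kernel and cokernel of `Sel(W'/K) → Sel(W'/K_∞)^Γ` — Mazur 1972,
Greenberg 1999 §3, any `p`, ⊗ℚ), whence `X_Γ ⊗ ℚ = 0`, whence `T ∤ char X` by the structure theory of
finitely generated torsion `ℤ₂⟦T⟧`-modules (pseudo-null = finite is invisible). In print ⊗ℚ for
semistable `𝔭`; recorded as a typed input because the tree has no control theorem over `K ≠ ℚ`.
A predicate; nothing asserted. [cite: GreenbergLNM1716, §3 (control at ordinary and multiplicative v ∣ p)] -/
def CycControlOverKAtTwoRat (W' : WeierstrassCurve K) [W'.IsElliptic] (c : ℤ_[2]) : Prop :=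
  haveI : Fact (Nat.Prime 2) := ⟨Nat.prime_two⟩
  W'.selmerCorank 2 = 0 →
    ∀ (κ : ZpExtension K 2) (γ : Field.absoluteGaloisGroup K),
      κ.IsCyclotomic → κ.IsTopGenerator γ → IsCycVariableOver K c γ →
    ∀ (D : W'.SelmerDualData κ γ) (g : IwasawaAlgebra 2), D.charIdeal = Ideal.span {g} →
      PowerSeries.constantCoeff (iwasawaToPowerSeries 2 g) ≠ 0

/-- **TYPED INPUT (converse) — non-vanishing transfer through the interpolation at `T = 0`**: if the
constant term of the `Λ_K`-generator `L` is non-zero then `L(W,1)·L(W^{(d_K)},1) ≠ 0`. CONTENT: the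
constant terms are `(1−α⁻¹)^{e}·L(E',1)/Ω⁺` (MTT; `e = 2` good ordinary, `e = 1` multiplicative — at a
SPLIT multiplicative `2` the factor vanishes: exceptional zero, EXCLUDED by the user of this input) times
`α^{-m}τ(χ)·L(E,1)/(Ω^{sgn}·i^{…})` (Birch, tree theorem for the odd symbol sum; the identification of the
limit `padicLMinusBranchCoeff f α 1 0` with that sum is the minus twin of
`isPAdicLFunctionOf_padicLFunction`, not yet in the tree). A predicate; nothing asserted.
[cite: MazurTateTeitelbaum1986Invent, §I.14 (14.3)] -/
def CycInterpolationNonvanishingAtTwo (W : WeierstrassCurve ℚ) (K : Type) [Field K] [NumberField K]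
    (L : PowerSeries ℚ_[2]) : Prop :=
  PowerSeries.constantCoeff L ≠ 0 →
    W.entireLFunction 1 * (W.quadraticTwist (NumberField.discr K : ℚ)).entireLFunction 1 ≠ 0

end Typed

/-! ## §4 Proved assemblies -/

section Doors

variable (W : WeierstrassCurve ℚ) [W.IsElliptic] [W.IsGloballyMinimal]
  (K : Type) [Field K] [NumberField K]
  (Wd : WeierstrassCurve ℚ) [Wd.IsElliptic] [Wd.IsGloballyMinimal]
  (W' : WeierstrassCurve K) [W'.IsElliptic] [W'.IsGloballyMinimal]

/-- **Door L2-K* (BSD₂ form): the `K*`-road composed with MEMO-1's kernel door L2-Q.** For `W/ℚ`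
globally minimal additive-at-`2` of analytic rank `≤ 1`, `K` (= `K*`) quadratic, `Wd` a globally
minimal model of the semistable twist `W^{(d_K)}` of analytic rank `≤ 1`, `W'` a globally minimal
`K`-model of `W_K`: the typed inputs (I-K*) `CycMainConjectureOverKAtTwo W' c L ϖ` and (II-K*)
`CycDescentOverKAtTwo W K W' c L ϖ`, the rank hypothesis `ord_{s=1}L(W/K,s) = 0`, and `BSD(Wd, 2)`
(the cell's K4ᵒ/K4ᵐ doors for the SEMISTABLE curve `Wd`, or a proved class of the lane) give
`BSD(W, 2)` — through Milne 1972 + Cassels + GZK (`AddTwoL2.bsdp_two_of_overK_of_twist`). No additive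
Iwasawa theory, no control at an additive prime, no `Δ = {±1}`-descent enters. [folklore] -/
theorem bsdp_two_of_cycRoad
    (hGZK : rank_eq_analyticRank_of_analyticRank_le_one) (hmod : hasEntireLFunction_rat)
    (hMilne : Milne1972.bsdQuotient_baseChange_quadratic)
    (hr : W.analyticRank ≤ 1) (h2 : Module.finrank ℚ K = 2)
    (hWd : ∃ C : VariableChange ℚ, C • W.quadraticTwist (NumberField.discr K : ℚ) = Wd)
    (hrd : Wd.analyticRank ≤ 1) (hW' : ∃ C : VariableChange K, C • W.baseChange K = W')
    {c : ℤ_[2]} {L : PowerSeries ℚ_[2]} {ϖ : ℚ}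
    (hIMC : CycMainConjectureOverKAtTwo W' c L ϖ) (hdesc : CycDescentOverKAtTwo W K W' c L ϖ)
    (hr0 : analyticRankEK W K = 0) (hd : BSDp Wd 2) : BSDp W 2 :=
  bsdp_two_of_overK_of_twist W K Wd W' hGZK hmod hMilne hr h2 hWd hrd hW' (hdesc hIMC hr0) hd

omit [W.IsGloballyMinimal] [W'.IsGloballyMinimal] in
/-- **The rank-`0` 2-converse over `K*` from the three μ-BLIND inputs.** For `W/ℚ`, `K` quadratic and
`W'` a `K`-model of `W_K` (so `Sel_{2^∞}(W'/K) = Sel_{2^∞}(W_K)`): Eisenstein ⊗ℚ over `K`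
(`CycEisensteinDivisibilityOverKAtTwoRat`), control ⊗ℚ (`CycControlOverKAtTwoRat`), the interpolation
transfer (`CycInterpolationNonvanishingAtTwo`), modularity, and the EXISTENCE of one cyclotomic datum
with a dual datum over `K` (`hdat`; the tree proves existence of `SelmerDualData` for topological
generators, `SelmerDualData.nonempty_selmerDualData`, and of cyclotomic `κ`, `exists_isCyclotomic` —
taken here as a hypothesis to keep the statement free of those named facts) give
`TwoConverseOverAt W K 0`: `corank Sel_{2^∞}(W_K) = 0 ⟹ ord_{s=1} L(W/K, s) = 0`. Proof: `g = L·h`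
generates `char X`; control gives `g(0) ≠ 0`, so `L(0) ≠ 0`; interpolation gives
`L(W,1)L(W^{(d_K)},1) ≠ 0`; orders of vanishing add (`analyticRankEK_eq_add_of`). No `μ`-invariant, no
integral main conjecture, no period is used. [folklore] -/
theorem twoConverseOverAt_zero_of_cycRoadRat (hE : hasEntireLFunction_rat)
    (hW' : ∃ C : VariableChange K, C • W.baseChange K = W') {c : ℤ_[2]} {L : PowerSeries ℚ_[2]}
    (hEis : CycEisensteinDivisibilityOverKAtTwoRat W' c L) (hctl : CycControlOverKAtTwoRat W' c)
    (hint : CycInterpolationNonvanishingAtTwo W K L)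
    (hdat : haveI : Fact (Nat.Prime 2) := ⟨Nat.prime_two⟩
      ∃ (κ : ZpExtension K 2) (γ : Field.absoluteGaloisGroup K),
        κ.IsCyclotomic ∧ κ.IsTopGenerator γ ∧ IsCycVariableOver K c γ ∧
          Nonempty (W'.SelmerDualData κ γ)) :
    TwoConverseOverAt W K 0 := by
  haveI : Fact (Nat.Prime 2) := ⟨Nat.prime_two⟩
  intro hcorank
  -- `Sel_{2^∞}(W'/K) = Sel_{2^∞}(W_K)` (a `K`-isomorphic model)
  obtain ⟨C, hC⟩ := hW'
  have hcorank' : W'.selmerCorank 2 = 0 := by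
    rw [← selmerCorank_eq_of_variableChange 2 hC]; exact hcorank
  obtain ⟨κ, γ, hκ, hγ, hc, ⟨D⟩⟩ := hdat
  obtain ⟨g, hg, h, hgh⟩ := hEis κ γ hκ hγ hc D
  have hg0 : PowerSeries.constantCoeff (iwasawaToPowerSeries 2 g) ≠ 0 :=
    hctl hcorank' κ γ hκ hγ hc D g hg
  have hL0 : PowerSeries.constantCoeff L ≠ 0 := by
    intro h0
    apply hg0
    rw [hgh, map_mul, h0, zero_mul]
  have hprod := hint hL0
  have hd : (NumberField.discr K : ℚ) ≠ 0 := by exact_mod_cast NumberField.discr_ne_zero K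
  haveI := W.isElliptic_quadraticTwist hd
  rw [analyticRankEK_eq_add_of hE W K,
    analyticRank_eq_zero_of_entireLFunction_one_ne_zero _ (left_ne_zero_of_mul hprod),
    analyticRank_eq_zero_of_entireLFunction_one_ne_zero _ (right_ne_zero_of_mul hprod)]

end Doors



end Summit.BirchSwinnertonDyer.Rank1Residual.X5.AddTwoL2Cyc

end
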